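import Mathlib
import Literature.Algebra.Polynomial.JacobianCriterion
import Summits.ValiantsHypothesis.ValiantsHypothesis.Theorems.MonotoneRestorationOrbitRestorationQPRowColumnLowerBound
import Summits.ValiantsHypothesis.ValiantsHypothesis.Theorems.MonotoneRestorationOrbitRestorationQPRowColumnStratum
import HarnessLib

/-!
# The derivative test for `ℂ[r, c]` is exact: `ℂ[r, c] = ⋂ ker (∂_{ab} − ∂_{a'b} − ∂_{ab'} + ∂_{a'b'})` (ORBIT currency)

Route MonotoneRestoration, crux `OrbitRestorationQP` (stmt-ValiantsHypothesis-18293), line `depth-three-rung`, registered stub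
`stub_sigmaPiSigmaValue` (A_∞).  Namespace `Summit.ValiantsHypothesis.ValiantsHypothesis.Theorems.RowColumnDerivativeConverse`.
Definition-free.

`Theorems/…RowColumnLowerBound.lean` proves the DERIVATIVE TEST: every element of `ℂ[r, c]` (the subalgebra generated by the row sums
`r_i = Σ_j x_ij` and the column sums `c_j = Σ_i x_ij` of the `n × n` matrix of variables) is killed by every double-difference
derivation `∂_{ab} − ∂_{a'b} − ∂_{ab'} + ∂_{a'b'}`, and `Theorems/…RowColumnStratum.lean` proves that every MATRIX-SYMMETRIC element of
`ℂ[r, c]` is `QPOrbitRestorable 9 n`.  This file proves the CONVERSE of the test, so that membership in the restorable stratum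
`ℂ[r, c]` is decided by finitely many linear conditions on `p`:

* `derivation_comm_of_generators` — an algebra map out of a polynomial ring intertwines a derivation of the source with a derivation
  of the target as soon as it does so on the variables (twisted-derivation uniqueness, by `MvPolynomial.induction_on`);
* `exists_adaptedCoords` — coordinates on the `(m+1) × (m+1)` matrix adapted to the double differences based at `(0, 0)`: an algebra
  endomorphism `φ = aeval g` with left inverse `ψ = aeval h` (`aeval_adapted_X`) such that `∂_{(i+1, j+1)} ∘ φ = φ ∘
  (∂_{(i+1,j+1)} − ∂_{(0,j+1)} − ∂_{(i+1,0)} + ∂_{(0,0)})` (`pderiv_aeval_adapted`) and `ψ` maps every variable of the border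
  `{a = 0} ∪ {b = 0}` into `ℂ[r, c]`;
* `mem_adjoin_rowcol_succ` — hence (characteristic `0`, `Literature…JacobianCriterion.notMem_vars_of_pderiv_eq_zero`): a polynomial
  killed by the `m²` derivations `∂_{(i+1,j+1)} − ∂_{(0,j+1)} − ∂_{(i+1,0)} + ∂_{(0,0)}` lies in `ℂ[r, c]`;
* `mem_adjoin_rowcol_of_forall_ddiffDeriv_eq_zero`, `mem_adjoin_rowcol_iff_forall_ddiffDeriv_eq_zero` — **`ℂ[r, c] = ⋂ ker`** of the
  double-difference derivations, at every level `n` (no symmetry hypothesis);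
* `qpOrbitRestorable_of_forall_ddiffDeriv_eq_zero`, `restoration_of_killed_family` — the restorable stratum of A_∞ in TEST form: a
  matrix-symmetric polynomial (family) killed by all double-difference derivations is `QPOrbitRestorable 9 n` (at every level).

Calibration: elementary (a change of coordinates adapted to the double-difference directions, and a polynomial with vanishing
partial derivative does not involve that variable); it makes the boundary of the `ℂ[r, c]` stratum exact.  Nothing here bears on
VP ≠ VNP. [folklore]

## References
* A. Dawar, G. Wilsenach, *Symmetric arithmetic circuits*, ToC 21 (2025), §3.3. [DawarWilsenach2025]
* J. E. Humphreys, *Reflection groups and Coxeter groups* (1990), §3.10 (partial derivatives in characteristic `0`). [Humphreys1990]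
-/

noncomputable section

open scoped Classical

-- `Summit.ValiantsHypothesis.ValiantsHypothesis.…` is the tree's single-conjunct layout (Sub = Summit).
set_option linter.dupNamespace false

namespace Summit.ValiantsHypothesis.ValiantsHypothesis.Theorems

namespace RowColumnDerivativeConverse

open MvPolynomial Equiv Literature.Computability.AlgebraicComplexity OrbitRestorationQPDepthThreeRung

/-! ### Intertwining derivations along an algebra map -/

/-- An algebra map `φ` out of a polynomial ring intertwines a derivation `D₁` of the source with a derivation `D₂` of the target
(`D₂ ∘ φ = φ ∘ D₁`) as soon as it does so on the variables. [folklore] -/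
theorem derivation_comm_of_generators {σ : Type*} {B : Type*} [CommRing B] [Algebra ℂ B]
    (φ : MvPolynomial σ ℂ →ₐ[ℂ] B) (D₁ : Derivation ℂ (MvPolynomial σ ℂ) (MvPolynomial σ ℂ)) (D₂ : Derivation ℂ B B)
    (hgen : ∀ w : σ, D₂ (φ (X w)) = φ (D₁ (X w))) (p : MvPolynomial σ ℂ) :
    D₂ (φ p) = φ (D₁ p) := by
  induction p using MvPolynomial.induction_on with
  | C a =>
    rw [← MvPolynomial.algebraMap_eq, AlgHom.commutes, Derivation.map_algebraMap, Derivation.map_algebraMap, map_zero]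
  | add p q hp hq => rw [map_add, map_add, map_add, map_add, hp, hq]
  | mul_X p w hp =>
    rw [map_mul, Derivation.leibniz, Derivation.leibniz]
    simp only [smul_eq_mul, map_add, map_mul]
    rw [hp, hgen]

variable {m : ℕ}

/-! ### Indicator sums over the successor indices -/

/-- `Σ_{j'' < m} [(c, j''+1) = (a, j+1)] = [c = a]`. [folklore] -/
theorem sum_ite_succ_snd (c a : Fin (m + 1)) (j : Fin m) :
    (∑ j'' : Fin m, (if ((c, j''.succ) : Fin (m + 1) × Fin (m + 1)) = (a, j.succ) then
      (1 : MvPolynomial (Fin (m + 1) × Fin (m + 1)) ℂ) else 0)) = if c = a then 1 else 0 := by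
  have h : (∑ b : Fin (m + 1), (if ((c, b) : Fin (m + 1) × Fin (m + 1)) = (a, j.succ) then
      (1 : MvPolynomial (Fin (m + 1) × Fin (m + 1)) ℂ) else 0)) =
      (if ((c, (0 : Fin (m + 1))) : Fin (m + 1) × Fin (m + 1)) = (a, j.succ) then
        (1 : MvPolynomial (Fin (m + 1) × Fin (m + 1)) ℂ) else 0) +
      ∑ j'' : Fin m, (if ((c, j''.succ) : Fin (m + 1) × Fin (m + 1)) = (a, j.succ) then
        (1 : MvPolynomial (Fin (m + 1) × Fin (m + 1)) ℂ) else 0) :=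
    Fin.sum_univ_succ (fun b : Fin (m + 1) => if ((c, b) : Fin (m + 1) × Fin (m + 1)) = (a, j.succ) then
      (1 : MvPolynomial (Fin (m + 1) × Fin (m + 1)) ℂ) else 0)
  rw [RowColumnLowerBound.sum_ite_row, if_neg (fun hP => Fin.succ_ne_zero j ((Prod.ext_iff.1 hP).2).symm), zero_add] at h
  exact h.symm

/-- `Σ_{i'' < m} [(i''+1, d) = (i+1, b)] = [d = b]`. [folklore] -/
theorem sum_ite_succ_fst (d b : Fin (m + 1)) (i : Fin m) :
    (∑ i'' : Fin m, (if ((i''.succ, d) : Fin (m + 1) × Fin (m + 1)) = (i.succ, b) then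
      (1 : MvPolynomial (Fin (m + 1) × Fin (m + 1)) ℂ) else 0)) = if d = b then 1 else 0 := by
  have h : (∑ a : Fin (m + 1), (if ((a, d) : Fin (m + 1) × Fin (m + 1)) = (i.succ, b) then
      (1 : MvPolynomial (Fin (m + 1) × Fin (m + 1)) ℂ) else 0)) =
      (if (((0 : Fin (m + 1)), d) : Fin (m + 1) × Fin (m + 1)) = (i.succ, b) then
        (1 : MvPolynomial (Fin (m + 1) × Fin (m + 1)) ℂ) else 0) +
      ∑ i'' : Fin m, (if ((i''.succ, d) : Fin (m + 1) × Fin (m + 1)) = (i.succ, b) then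
        (1 : MvPolynomial (Fin (m + 1) × Fin (m + 1)) ℂ) else 0) :=
    Fin.sum_univ_succ (fun a : Fin (m + 1) => if ((a, d) : Fin (m + 1) × Fin (m + 1)) = (i.succ, b) then
      (1 : MvPolynomial (Fin (m + 1) × Fin (m + 1)) ℂ) else 0)
  rw [RowColumnLowerBound.sum_ite_col, if_neg (fun hP => Fin.succ_ne_zero i ((Prod.ext_iff.1 hP).1).symm), zero_add] at h
  exact h.symm

/-- `Σ_{i'', j'' < m} [(i''+1, j''+1) = (i+1, j+1)] = 1`. [folklore] -/
theorem sum_sum_ite_succ (i j : Fin m) :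
    (∑ i'' : Fin m, ∑ j'' : Fin m, (if ((i''.succ, j''.succ) : Fin (m + 1) × Fin (m + 1)) = (i.succ, j.succ) then
      (1 : MvPolynomial (Fin (m + 1) × Fin (m + 1)) ℂ) else 0)) = 1 := by
  simp_rw [sum_ite_succ_snd]
  rw [Finset.sum_eq_single i]
  · rw [if_pos rfl]
  · intro i'' _ hi''
    exact if_neg (fun h => hi'' (Fin.succ_inj.1 h))
  · exact fun hi => absurd (Finset.mem_univ _) hi

/-! ### Coordinates adapted to the double differences based at `(0, 0)` -/

/-- **Adapted coordinates.**  On the `(m+1) × (m+1)` matrix there are substitutions `g` (old variables in terms of the new ones)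
and `h` (new variables in terms of the old ones): the new variables are `s_{ij} ↔ x_{(i+1,j+1)}` (coefficients along the double
differences `e_{(i+1,j+1)} − e_{(0,j+1)} − e_{(i+1,0)} + e_{(0,0)}`), the column sums `c_{j+1}`, the row sums `r_{i+1}`, and
`c_0 − Σ_i r_{i+1}`. [folklore] -/
theorem exists_adaptedCoords (m : ℕ) :
    ∃ g h : Fin (m + 1) × Fin (m + 1) → MvPolynomial (Fin (m + 1) × Fin (m + 1)) ℂ,
      g (0, 0) = X (0, 0) + ∑ i : Fin m, ∑ j : Fin m, X (i.succ, j.succ) ∧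
      (∀ j : Fin m, g (0, j.succ) = X (0, j.succ) - ∑ i : Fin m, X (i.succ, j.succ)) ∧
      (∀ i : Fin m, g (i.succ, 0) = X (i.succ, 0) - ∑ j : Fin m, X (i.succ, j.succ)) ∧
      (∀ i j : Fin m, g (i.succ, j.succ) = X (i.succ, j.succ)) ∧
      h (0, 0) = (∑ a : Fin (m + 1), X (a, 0)) - ∑ i : Fin m, ∑ b : Fin (m + 1), X (i.succ, b) ∧
      (∀ j : Fin m, h (0, j.succ) = ∑ a : Fin (m + 1), X (a, j.succ)) ∧
      (∀ i : Fin m, h (i.succ, 0) = ∑ b : Fin (m + 1), X (i.succ, b)) ∧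
      (∀ i j : Fin m, h (i.succ, j.succ) = X (i.succ, j.succ)) := by
  refine ⟨fun q => if q.1 = 0 then
      (if q.2 = 0 then X (0, 0) + ∑ i : Fin m, ∑ j : Fin m, X (i.succ, j.succ)
        else X (0, q.2) - ∑ i : Fin m, X (i.succ, q.2))
      else (if q.2 = 0 then X (q.1, 0) - ∑ j : Fin m, X (q.1, j.succ) else X q),
    fun q => if q.1 = 0 then
      (if q.2 = 0 then (∑ a : Fin (m + 1), X (a, 0)) - ∑ i : Fin m, ∑ b : Fin (m + 1), X (i.succ, b)
        else ∑ a : Fin (m + 1), X (a, q.2))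
      else (if q.2 = 0 then ∑ b : Fin (m + 1), X (q.1, b) else X q),
    ?_, ?_, ?_, ?_, ?_, ?_, ?_, ?_⟩
  · simp
  · intro j
    simp [Fin.succ_ne_zero]
  · intro i
    simp [Fin.succ_ne_zero]
  · intro i j
    simp [Fin.succ_ne_zero]
  · simp
  · intro j
    simp [Fin.succ_ne_zero]
  · intro i
    simp [Fin.succ_ne_zero]
  · intro i j
    simp [Fin.succ_ne_zero]

/-- `ψ ∘ φ = id` on the variables: substituting the new variables by their expressions in the old ones undoes `g`. [folklore] -/
theorem aeval_adapted_X (g h : Fin (m + 1) × Fin (m + 1) → MvPolynomial (Fin (m + 1) × Fin (m + 1)) ℂ)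
    (hg00 : g (0, 0) = X (0, 0) + ∑ i : Fin m, ∑ j : Fin m, X (i.succ, j.succ))
    (hg0 : ∀ j : Fin m, g (0, j.succ) = X (0, j.succ) - ∑ i : Fin m, X (i.succ, j.succ))
    (hg0' : ∀ i : Fin m, g (i.succ, 0) = X (i.succ, 0) - ∑ j : Fin m, X (i.succ, j.succ))
    (hgs : ∀ i j : Fin m, g (i.succ, j.succ) = X (i.succ, j.succ))
    (hh00 : h (0, 0) = (∑ a : Fin (m + 1), X (a, 0)) - ∑ i : Fin m, ∑ b : Fin (m + 1), X (i.succ, b))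
    (hh0 : ∀ j : Fin m, h (0, j.succ) = ∑ a : Fin (m + 1), X (a, j.succ))
    (hh0' : ∀ i : Fin m, h (i.succ, 0) = ∑ b : Fin (m + 1), X (i.succ, b))
    (hhs : ∀ i j : Fin m, h (i.succ, j.succ) = X (i.succ, j.succ)) (q : Fin (m + 1) × Fin (m + 1)) :
    aeval h (g q) = X q := by
  obtain ⟨a, b⟩ := q
  rcases Fin.eq_zero_or_eq_succ a with rfl | ⟨i, rfl⟩ <;> rcases Fin.eq_zero_or_eq_succ b with rfl | ⟨j, rfl⟩
  · rw [hg00, map_add, aeval_X, hh00]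
    simp_rw [map_sum, aeval_X, hhs]
    simp_rw [Fin.sum_univ_succ, Finset.sum_add_distrib]
    ring
  · rw [hg0 j, map_sub, aeval_X, hh0 j]
    simp_rw [map_sum, aeval_X, hhs]
    rw [Fin.sum_univ_succ]
    ring
  · rw [hg0' i, map_sub, aeval_X, hh0' i]
    simp_rw [map_sum, aeval_X, hhs]
    rw [Fin.sum_univ_succ]
    ring
  · rw [hgs, aeval_X, hhs]

/-- The chain rule on the variables: `∂_{(i+1,j+1)} (g x_q) = φ ((∂_{(i+1,j+1)} − ∂_{(0,j+1)} − ∂_{(i+1,0)} + ∂_{(0,0)}) x_q)`.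
[folklore] -/
theorem pderiv_adapted_X (g : Fin (m + 1) × Fin (m + 1) → MvPolynomial (Fin (m + 1) × Fin (m + 1)) ℂ)
    (hg00 : g (0, 0) = X (0, 0) + ∑ i : Fin m, ∑ j : Fin m, X (i.succ, j.succ))
    (hg0 : ∀ j : Fin m, g (0, j.succ) = X (0, j.succ) - ∑ i : Fin m, X (i.succ, j.succ))
    (hg0' : ∀ i : Fin m, g (i.succ, 0) = X (i.succ, 0) - ∑ j : Fin m, X (i.succ, j.succ))
    (hgs : ∀ i j : Fin m, g (i.succ, j.succ) = X (i.succ, j.succ)) (i j : Fin m) (q : Fin (m + 1) × Fin (m + 1)) :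
    pderiv (i.succ, j.succ) (g q) =
      aeval g (pderiv (i.succ, j.succ) (X q : MvPolynomial (Fin (m + 1) × Fin (m + 1)) ℂ) - pderiv (0, j.succ) (X q) -
        pderiv (i.succ, 0) (X q) + pderiv (0, 0) (X q)) := by
  rw [RowColumnLowerBound.pderiv_X_pair, RowColumnLowerBound.pderiv_X_pair, RowColumnLowerBound.pderiv_X_pair,
    RowColumnLowerBound.pderiv_X_pair]
  obtain ⟨a, b⟩ := q
  rcases Fin.eq_zero_or_eq_succ a with rfl | ⟨i', rfl⟩ <;> rcases Fin.eq_zero_or_eq_succ b with rfl | ⟨j', rfl⟩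
  · have hc1 : ¬ (((0 : Fin (m + 1)), (0 : Fin (m + 1))) : Fin (m + 1) × Fin (m + 1)) = (i.succ, j.succ) :=
      fun hP => Fin.succ_ne_zero i ((Prod.ext_iff.1 hP).1).symm
    have hc2 : ¬ (((0 : Fin (m + 1)), (0 : Fin (m + 1))) : Fin (m + 1) × Fin (m + 1)) = (0, j.succ) :=
      fun hP => Fin.succ_ne_zero j ((Prod.ext_iff.1 hP).2).symm
    have hc3 : ¬ (((0 : Fin (m + 1)), (0 : Fin (m + 1))) : Fin (m + 1) × Fin (m + 1)) = (i.succ, 0) :=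
      fun hP => Fin.succ_ne_zero i ((Prod.ext_iff.1 hP).1).symm
    rw [if_neg hc1, if_neg hc2, if_neg hc3, if_pos rfl, hg00, map_add, RowColumnLowerBound.pderiv_X_pair, if_neg hc1]
    simp_rw [map_sum, RowColumnLowerBound.pderiv_X_pair]
    rw [sum_sum_ite_succ]
    simp
  · have hc1 : ¬ (((0 : Fin (m + 1)), j'.succ) : Fin (m + 1) × Fin (m + 1)) = (i.succ, j.succ) :=
      fun hP => Fin.succ_ne_zero i ((Prod.ext_iff.1 hP).1).symm
    have hc3 : ¬ (((0 : Fin (m + 1)), j'.succ) : Fin (m + 1) × Fin (m + 1)) = (i.succ, 0) :=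
      fun hP => Fin.succ_ne_zero i ((Prod.ext_iff.1 hP).1).symm
    have hc4 : ¬ (((0 : Fin (m + 1)), j'.succ) : Fin (m + 1) × Fin (m + 1)) = (0, 0) :=
      fun hP => Fin.succ_ne_zero j' (Prod.ext_iff.1 hP).2
    rw [if_neg hc1, if_neg hc3, if_neg hc4, hg0 j', map_sub, RowColumnLowerBound.pderiv_X_pair, if_neg hc1]
    simp_rw [map_sum, RowColumnLowerBound.pderiv_X_pair]
    rw [sum_ite_succ_fst]
    by_cases hj : j' = j
    · subst hj
      rw [if_pos rfl, if_pos rfl]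
      simp
    · have hc2 : ¬ (((0 : Fin (m + 1)), j'.succ) : Fin (m + 1) × Fin (m + 1)) = (0, j.succ) :=
        fun hP => hj (Fin.succ_inj.1 (Prod.ext_iff.1 hP).2)
      have hc2' : ¬ (j'.succ = j.succ) := fun h => hj (Fin.succ_inj.1 h)
      rw [if_neg hc2, if_neg hc2']
      simp
  · have hc1 : ¬ ((i'.succ, (0 : Fin (m + 1))) : Fin (m + 1) × Fin (m + 1)) = (i.succ, j.succ) :=
      fun hP => Fin.succ_ne_zero j ((Prod.ext_iff.1 hP).2).symm
    have hc2 : ¬ ((i'.succ, (0 : Fin (m + 1))) : Fin (m + 1) × Fin (m + 1)) = (0, j.succ) :=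
      fun hP => Fin.succ_ne_zero i' (Prod.ext_iff.1 hP).1
    have hc4 : ¬ ((i'.succ, (0 : Fin (m + 1))) : Fin (m + 1) × Fin (m + 1)) = (0, 0) :=
      fun hP => Fin.succ_ne_zero i' (Prod.ext_iff.1 hP).1
    rw [if_neg hc1, if_neg hc2, if_neg hc4, hg0' i', map_sub, RowColumnLowerBound.pderiv_X_pair, if_neg hc1]
    simp_rw [map_sum, RowColumnLowerBound.pderiv_X_pair]
    rw [sum_ite_succ_snd]
    by_cases hi : i' = i
    · subst hi
      rw [if_pos rfl, if_pos rfl]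
      simp
    · have hc3 : ¬ ((i'.succ, (0 : Fin (m + 1))) : Fin (m + 1) × Fin (m + 1)) = (i.succ, 0) :=
        fun hP => hi (Fin.succ_inj.1 (Prod.ext_iff.1 hP).1)
      have hc3' : ¬ (i'.succ = i.succ) := fun h => hi (Fin.succ_inj.1 h)
      rw [if_neg hc3, if_neg hc3']
      simp
  · have hc2 : ¬ ((i'.succ, j'.succ) : Fin (m + 1) × Fin (m + 1)) = (0, j.succ) :=
      fun hP => Fin.succ_ne_zero i' (Prod.ext_iff.1 hP).1
    have hc3 : ¬ ((i'.succ, j'.succ) : Fin (m + 1) × Fin (m + 1)) = (i.succ, 0) :=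
      fun hP => Fin.succ_ne_zero j' (Prod.ext_iff.1 hP).2
    have hc4 : ¬ ((i'.succ, j'.succ) : Fin (m + 1) × Fin (m + 1)) = (0, 0) :=
      fun hP => Fin.succ_ne_zero i' (Prod.ext_iff.1 hP).1
    rw [if_neg hc2, if_neg hc3, if_neg hc4, hgs, RowColumnLowerBound.pderiv_X_pair]
    by_cases hq : ((i'.succ, j'.succ) : Fin (m + 1) × Fin (m + 1)) = (i.succ, j.succ)
    · rw [if_pos hq]; simp
    · rw [if_neg hq]; simp

/-- **Chain rule in the adapted coordinates**: `∂_{(i+1,j+1)} (φ p) = φ ((∂_{(i+1,j+1)} − ∂_{(0,j+1)} − ∂_{(i+1,0)} + ∂_{(0,0)}) p)`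
for `φ = aeval g`. [folklore] -/
theorem pderiv_aeval_adapted (g : Fin (m + 1) × Fin (m + 1) → MvPolynomial (Fin (m + 1) × Fin (m + 1)) ℂ)
    (hg00 : g (0, 0) = X (0, 0) + ∑ i : Fin m, ∑ j : Fin m, X (i.succ, j.succ))
    (hg0 : ∀ j : Fin m, g (0, j.succ) = X (0, j.succ) - ∑ i : Fin m, X (i.succ, j.succ))
    (hg0' : ∀ i : Fin m, g (i.succ, 0) = X (i.succ, 0) - ∑ j : Fin m, X (i.succ, j.succ))
    (hgs : ∀ i j : Fin m, g (i.succ, j.succ) = X (i.succ, j.succ)) (i j : Fin m)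
    (p : MvPolynomial (Fin (m + 1) × Fin (m + 1)) ℂ) :
    pderiv (i.succ, j.succ) (aeval g p) =
      aeval g (pderiv (i.succ, j.succ) p - pderiv (0, j.succ) p - pderiv (i.succ, 0) p + pderiv (0, 0) p) := by
  have h := derivation_comm_of_generators (aeval g)
    (pderiv (i.succ, j.succ) - pderiv (0, j.succ) - pderiv (i.succ, 0) + pderiv (0, 0)) (pderiv (i.succ, j.succ))
    (fun w => by
      rw [aeval_X, Derivation.add_apply, Derivation.sub_apply, Derivation.sub_apply]
      exact pderiv_adapted_X g hg00 hg0 hg0' hgs i j w) p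
  rw [h, Derivation.add_apply, Derivation.sub_apply, Derivation.sub_apply]

/-! ### The converse of the derivative test -/

/-- **CONVERSE OF THE DERIVATIVE TEST (level `m + 1`, reduced family).**  A polynomial on the `(m+1) × (m+1)` matrix killed by the
`m²` double-difference derivations `∂_{(i+1,j+1)} − ∂_{(0,j+1)} − ∂_{(i+1,0)} + ∂_{(0,0)}` lies in `ℂ[r, c]`. [folklore] -/
theorem mem_adjoin_rowcol_succ {p : MvPolynomial (Fin (m + 1) × Fin (m + 1)) ℂ}
    (hD : ∀ i j : Fin m, pderiv (i.succ, j.succ) p - pderiv (0, j.succ) p - pderiv (i.succ, 0) p + pderiv (0, 0) p = 0) :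
    p ∈ Algebra.adjoin ℂ
      (Set.range (fun i : Fin (m + 1) => ∑ j : Fin (m + 1), (X (i, j) : MvPolynomial (Fin (m + 1) × Fin (m + 1)) ℂ)) ∪
        Set.range (fun j : Fin (m + 1) => ∑ i : Fin (m + 1), (X (i, j) : MvPolynomial (Fin (m + 1) × Fin (m + 1)) ℂ))) := by
  obtain ⟨g, h, hg00, hg0, hg0', hgs, hh00, hh0, hh0', hhs⟩ := exists_adaptedCoords m
  -- `ψ ∘ φ = id`, so `p = ψ (φ p)`
  have hcomp : (aeval h).comp (aeval g) = AlgHom.id ℂ (MvPolynomial (Fin (m + 1) × Fin (m + 1)) ℂ) := by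
    refine MvPolynomial.algHom_ext fun w => ?_
    rw [AlgHom.comp_apply, AlgHom.id_apply, aeval_X]
    exact aeval_adapted_X g h hg00 hg0 hg0' hgs hh00 hh0 hh0' hhs w
  have hp : p = aeval h (aeval g p) := by
    have e := AlgHom.congr_fun hcomp p
    rw [AlgHom.comp_apply, AlgHom.id_apply] at e
    exact e.symm
  -- `φ p` does not involve the interior variables `(i+1, j+1)`
  have hvars : ∀ i j : Fin m, ((i.succ, j.succ) : Fin (m + 1) × Fin (m + 1)) ∉ (aeval g p).vars := by
    intro i j
    refine Literature.Algebra.Polynomial.JacobianCriterion.notMem_vars_of_pderiv_eq_zero ?_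
    rw [pderiv_aeval_adapted g hg00 hg0 hg0' hgs i j p, hD i j, map_zero]
  have hsupp : aeval g p ∈ MvPolynomial.supported ℂ {v : Fin (m + 1) × Fin (m + 1) | v.1 = 0 ∨ v.2 = 0} := by
    rw [MvPolynomial.mem_supported]
    rintro ⟨a, b⟩ hv
    rcases Fin.eq_zero_or_eq_succ a with rfl | ⟨i, rfl⟩
    · exact Or.inl rfl
    rcases Fin.eq_zero_or_eq_succ b with rfl | ⟨j, rfl⟩
    · exact Or.inr rfl
    · exact absurd (Finset.mem_coe.1 hv) (hvars i j)
  -- `ψ` maps the border variables into `ℂ[r, c]`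
  have hle : MvPolynomial.supported ℂ {v : Fin (m + 1) × Fin (m + 1) | v.1 = 0 ∨ v.2 = 0} ≤
      Subalgebra.comap (aeval h) (Algebra.adjoin ℂ
        (Set.range (fun i : Fin (m + 1) => ∑ j : Fin (m + 1), (X (i, j) : MvPolynomial (Fin (m + 1) × Fin (m + 1)) ℂ)) ∪
          Set.range (fun j : Fin (m + 1) => ∑ i : Fin (m + 1), (X (i, j) : MvPolynomial (Fin (m + 1) × Fin (m + 1)) ℂ)))) := by
    rw [MvPolynomial.supported_eq_adjoin_X]
    refine Algebra.adjoin_le ?_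
    rintro _ ⟨⟨a, b⟩, hv, rfl⟩
    rw [SetLike.mem_coe, Subalgebra.mem_comap, aeval_X]
    rcases Fin.eq_zero_or_eq_succ a with rfl | ⟨i, rfl⟩ <;> rcases Fin.eq_zero_or_eq_succ b with rfl | ⟨j, rfl⟩
    · rw [hh00]
      exact Subalgebra.sub_mem _ (Algebra.subset_adjoin (Or.inr ⟨0, rfl⟩))
        (Subalgebra.sum_mem _ fun i _ => Algebra.subset_adjoin (Or.inl ⟨i.succ, rfl⟩))
    · rw [hh0 j]
      exact Algebra.subset_adjoin (Or.inr ⟨j.succ, rfl⟩)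
    · rw [hh0' i]
      exact Algebra.subset_adjoin (Or.inl ⟨i.succ, rfl⟩)
    · exfalso
      rcases hv with hv | hv
      · exact Fin.succ_ne_zero i hv
      · exact Fin.succ_ne_zero j hv
  rw [hp]
  exact (Subalgebra.mem_comap _ _ _).1 (hle hsupp)

/-- **CONVERSE OF THE DERIVATIVE TEST.**  A polynomial on the `n × n` matrix killed by every double-difference derivation
`∂_{ab} − ∂_{a'b} − ∂_{ab'} + ∂_{a'b'}` lies in `ℂ[r, c]` (no symmetry hypothesis). [folklore] -/
theorem mem_adjoin_rowcol_of_forall_ddiffDeriv_eq_zero {n : ℕ} {p : MvPolynomial (Fin n × Fin n) ℂ}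
    (hD : ∀ a a' b b' : Fin n, pderiv (a, b) p - pderiv (a', b) p - pderiv (a, b') p + pderiv (a', b') p = 0) :
    p ∈ Algebra.adjoin ℂ (Set.range (fun i : Fin n => ∑ j : Fin n, (X (i, j) : MvPolynomial (Fin n × Fin n) ℂ)) ∪
      Set.range (fun j : Fin n => ∑ i : Fin n, (X (i, j) : MvPolynomial (Fin n × Fin n) ℂ))) := by
  cases n with
  | zero =>
    rw [MvPolynomial.eq_C_of_isEmpty p, ← MvPolynomial.algebraMap_eq]
    exact Subalgebra.algebraMap_mem _ _
  | succ m => exact mem_adjoin_rowcol_succ fun i j => hD i.succ 0 j.succ 0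

/-- **`ℂ[r, c] = ⋂ ker (∂_{ab} − ∂_{a'b} − ∂_{ab'} + ∂_{a'b'})`**: the derivative test of `…RowColumnLowerBound.lean` is exact.
[folklore] -/
theorem mem_adjoin_rowcol_iff_forall_ddiffDeriv_eq_zero {n : ℕ} (p : MvPolynomial (Fin n × Fin n) ℂ) :
    p ∈ Algebra.adjoin ℂ (Set.range (fun i : Fin n => ∑ j : Fin n, (X (i, j) : MvPolynomial (Fin n × Fin n) ℂ)) ∪
      Set.range (fun j : Fin n => ∑ i : Fin n, (X (i, j) : MvPolynomial (Fin n × Fin n) ℂ))) ↔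
    ∀ a a' b b' : Fin n, pderiv (a, b) p - pderiv (a', b) p - pderiv (a, b') p + pderiv (a', b') p = 0 :=
  ⟨fun h a a' b b' => RowColumnLowerBound.ddiffDeriv_eq_zero_of_mem_adjoin_rowcol h a a' b b',
    mem_adjoin_rowcol_of_forall_ddiffDeriv_eq_zero⟩

/-- At level `m + 1` the `m²` derivations based at `(0, 0)` already decide membership in `ℂ[r, c]`. [folklore] -/
theorem mem_adjoin_rowcol_iff_succ (p : MvPolynomial (Fin (m + 1) × Fin (m + 1)) ℂ) :
    p ∈ Algebra.adjoin ℂ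
      (Set.range (fun i : Fin (m + 1) => ∑ j : Fin (m + 1), (X (i, j) : MvPolynomial (Fin (m + 1) × Fin (m + 1)) ℂ)) ∪
        Set.range (fun j : Fin (m + 1) => ∑ i : Fin (m + 1), (X (i, j) : MvPolynomial (Fin (m + 1) × Fin (m + 1)) ℂ))) ↔
    ∀ i j : Fin m, pderiv (i.succ, j.succ) p - pderiv (0, j.succ) p - pderiv (i.succ, 0) p + pderiv (0, 0) p = 0 :=
  ⟨fun h i j => RowColumnLowerBound.ddiffDeriv_eq_zero_of_mem_adjoin_rowcol h i.succ 0 j.succ 0, mem_adjoin_rowcol_succ⟩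

/-! ### The restorable stratum in test form -/

/-- **THE `ℂ[r, c]` STRATUM OF A_∞ IN TEST FORM.**  A matrix-symmetric polynomial killed by every double-difference derivation
`∂_{ab} − ∂_{a'b} − ∂_{ab'} + ∂_{a'b'}` has a square-symmetric circuit of orbit size `≤ 2^((log₂ n + 9)^9)`. [folklore] -/
theorem qpOrbitRestorable_of_forall_ddiffDeriv_eq_zero {n : ℕ} {p : MvPolynomial (Fin n × Fin n) ℂ}
    (hsym : ∀ σ τ : Perm (Fin n), rename (fun q : Fin n × Fin n => (σ q.1, τ q.2)) p = p)
    (hD : ∀ a a' b b' : Fin n, pderiv (a, b) p - pderiv (a', b) p - pderiv (a, b') p + pderiv (a', b') p = 0) :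
    QPOrbitRestorable 9 n p :=
  RowColumnStratum.qpOrbitRestorable_of_mem_adjoin_rowcol hsym (mem_adjoin_rowcol_of_forall_ddiffDeriv_eq_zero hD)

/-- **The stratum in the shape of the stub `stub_sigmaPiSigmaValue`**: a matrix-symmetric FAMILY killed at every level by all
double-difference derivations is quasi-polynomially orbit-restorable with the absolute constant `c = 9` (no circuit hypothesis is
needed on this stratum). [folklore] -/
theorem restoration_of_killed_family (f : (n : ℕ) → MvPolynomial (Fin n × Fin n) ℂ) (hsym : IsMatrixSymmetric f)
    (hD : ∀ n : ℕ, ∀ a a' b b' : Fin n,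
      pderiv (a, b) (f n) - pderiv (a', b) (f n) - pderiv (a, b') (f n) + pderiv (a', b') (f n) = 0) :
    ∃ c : ℕ, ∀ n : ℕ, QPOrbitRestorable c n (f n) :=
  ⟨9, fun n => qpOrbitRestorable_of_forall_ddiffDeriv_eq_zero (hsym n) (hD n)⟩

/-- **EXACT DICHOTOMY for matrix-symmetric polynomials** (the two files `…RowColumnStratum.lean` / `…RowColumnLowerBound.lean` glued
along the exact test): either `p` is killed by all double-difference derivations — and then it is `QPOrbitRestorable 9 n` — or some
derivation does not kill it — and then every depth-three representation `p = Σ_{i<k} C(a i) · Π (L i)` with affine factors has at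
least `(n−1)²` distinct factors. [folklore] -/
theorem restorable_or_sq_le_card_distinct_factors {n : ℕ} {p : MvPolynomial (Fin n × Fin n) ℂ}
    (hsym : ∀ σ τ : Perm (Fin n), rename (fun q : Fin n × Fin n => (σ q.1, τ q.2)) p = p) :
    QPOrbitRestorable 9 n p ∨
      ∀ {k : ℕ} (a : Fin k → ℂ) (L : Fin k → Multiset (MvPolynomial (Fin n × Fin n) ℂ)),
        (∀ i, ∀ ℓ ∈ L i, ℓ.totalDegree ≤ 1) → p = ∑ i, C (a i) * (L i).prod →
          (n - 1) ^ 2 ≤ (Finset.univ.biUnion fun i => (L i).toFinset).card := by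
  by_cases hD : ∀ a a' b b' : Fin n, pderiv (a, b) p - pderiv (a', b) p - pderiv (a, b') p + pderiv (a', b') p = 0
  · exact Or.inl (qpOrbitRestorable_of_forall_ddiffDeriv_eq_zero hsym hD)
  · push Not at hD
    obtain ⟨a₀, a₀', b₀, b₀', hne⟩ := hD
    exact Or.inr fun a L hL hp => RowColumnLowerBound.sq_le_card_distinct_factors hsym hne a L hL hp

end RowColumnDerivativeConverse

end Summit.ValiantsHypothesis.ValiantsHypothesis.Theorems

end
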